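import Summits.QuantumAdvantage.AdviceFreeQNC0.NPGamma37Assembly
import Summits.QuantumAdvantage.AdviceFreeQNC0.NPGamma37
import HarnessLib

/-!
# Cell qa-qnc0 — rung (NP-Γ) `RingHardSparse3` (sparse-coupling hardness at `p = 3`, any degree): THE THEOREM `ringHardSparse3 : NPGamma37.RingHardSparse3` (e = 6, C = 8, n₀ = 200).

Planner qa-qnc0-p2 gen 34 (INBOX P2-34c/P2-34d, memo HOME/qa-qnc0-p2/ROUND-34P2.md §4.4); split of the kernel-checked
monolith `HOME/qa-qnc0-p2/line34/NPGammaProof37.lean` (rc 0, 0 sorries, axioms propext/Classical.choice/Quot.sound) into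
≤ 400-line parts `NPGamma37{Slicing,Span,Family,Assembly,Sparse}.lean`.  Part I (𝔽₄ Kraft + sparsity) and the 𝔽₄/ℤ₃ algebra
are IMPORTED from the landed (NP₁) files `AffBells37{Kraft,Sparse,Resonance}`, Part II (the insulator-involution resonance
MGF (R′)) from the landed `Resonance37G` — identical declarations, opened by name below.

COROLLARIES (`ringHardFewCouplings3`, `ringHardFanIn3`) live in `NPGamma37Corollaries.lean` (imports this file + `NPGamma37Few` + `NPGamma37FanIn`).
THIS FILE: `H1'_H2'_of_insulated` (insulation clauses ⇒ (H1′)/(H2′)), the numeric lemmas `growthA`/`growthB`, and the proof of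
`NPGamma37.RingHardSparse3` from `sparseLoss` with `F = 8k`, `k = log₂ N`, `N = n + 1 ≥ 200` (so `k ≥ 7`).

THEOREM (NP-Γ, file `NPGamma37Sparse`): for `n ≥ 200`, every strategy `P : Fin n → CubeFn (ZMod 3) n` with all outputs in
`span {mono S : S ∈ 𝓢}`, `𝓢` admitting `8·log₂ n` insulated windows (`NPGamma37.InsulatedWindows`), satisfies
`#{x odd : Rel x (P · x = 1)} ≤ (1 − n^{−6})·2^{n−1}` — no degree hypothesis.  Supports crux stmt-QuantumAdvantage-22907
(dense coupling — the residual core of `RingHardOdd 3` — is NOT touched).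
-/

noncomputable section

namespace Summit.QuantumAdvantage.AdviceFreeQNC0.NPGamma37Proof

open Finset F4
open Classical
open Summit.QuantumAdvantage.AdviceFreeQNC0.AffBells37 (expo chiZ exists_ne_one_of_mass_lt ev L sparse sparse_ne_one
  two_pow_L_le ωz ωz_zero ωz_add ωz_natCast ωz_sq lin chiZ_eq_ωz lin_add lin_mul lin_single ιF_xor ιF_decide_eq_zero
  ιF_eq_omega ιF_ringWinU)
open Summit.QuantumAdvantage.AdviceFreeQNC0.Resonance37G (four_orbit_le orbit_mgf sg bt sg_not slope_eq no_three
  blockCpl blockCpl_blockCpl blockCpl_involutive blockCpl_apply_of_not_mem uExt_blockCpl xN xN_eq_xOfU xN_blockCpl_of_ne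
  xN_blockCpl_left xN_blockCpl_right Inv letter resonance_windows)
-- `wt` (weight of a cube-restricted character) is written `AffBells37.wt` throughout: the bare name would resolve to the
-- walk-word weight `Summit.QuantumAdvantage.AdviceFreeQNC0.wt` of `Elimination.lean`.

variable {F : ℕ}

section Slicing

open Literature.Computability.QuantumComplexity Literature.Computability.QuantumComplexity.RingHLF
open Literature.Computability.MetaComplexity
open AffBells23 AffBells26

variable {n : ℕ}
variable {N : ℕ}

open Summit.QuantumAdvantage.AdviceFreeQNC0.NPGamma37 (NCoupled InsulatedWindows RingHardSparse3 RingHardFewCouplings3)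

/-! ### (NP-Γ) THE STATEMENT (verbatim `NPGamma37`) AND ITS PROOF -/

/-- the insulation clauses give (H1′) and (H2′). -/
theorem H1'_H2'_of_insulated {𝓢 : Set (Finset (Fin N))} {p q : ℕ → ℕ}
    (h4 : ∀ j < F, ∀ j' < F, j ≠ j' → ∀ a ∈ ({p j, p j + 1} : Finset ℕ), ∀ b ∈ ({p j', p j' + 1} : Finset ℕ),
        ¬ NCoupled 𝓢 a b)
    (h5 : ∀ i ≤ F, ∀ j < F, ∀ b ∈ ({p j, p j + 1} : Finset ℕ), ¬ NCoupled 𝓢 (q i) b) :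
    H1' p F 𝓢 ∧ H2' p q F 𝓢 := by
  constructor
  · rintro S hS j j' hjj ⟨i, hi, hiv⟩ ⟨i', hi', hi'v⟩
    refine h4 j.val j.isLt j'.val j'.isLt (fun h => hjj (Fin.ext h)) i.val ?_ i'.val ?_
      ⟨S, hS, i, hi, i', hi', rfl, rfl⟩
    · rcases hiv with h | h <;> simp [h]
    · rcases hi'v with h | h <;> simp [h]
  · rintro S hS i hi ⟨c, hc, hcq⟩ j ⟨i', hi', hi'v⟩
    refine h5 i hi j.val j.isLt i'.val ?_ ⟨S, hS, c, hc, i', hi', hcq, rfl⟩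
    rcases hi'v with h | h <;> simp [h]

/-- Numerics: `32·13122^k ≤ 65536^k` for `k ≥ 3`. -/
theorem growthA (k : ℕ) (hk : 3 ≤ k) : 32 * 13122 ^ k ≤ 65536 ^ k := by
  induction k, hk using Nat.le_induction with
  | base => norm_num
  | succ k hk ih =>
    calc 32 * 13122 ^ (k + 1) = 13122 * (32 * 13122 ^ k) := by ring
      _ ≤ 65536 * 65536 ^ k := Nat.mul_le_mul (by norm_num) ih
      _ = 65536 ^ (k + 1) := by ring

/-- Numerics: `8·2^k·(1+64k) ≤ 256^k` for `k ≥ 2`. -/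
theorem growthB (k : ℕ) (hk : 2 ≤ k) : 8 * 2 ^ k * (1 + 64 * k) ≤ 256 ^ k := by
  induction k, hk using Nat.le_induction with
  | base => norm_num
  | succ k hk ih =>
    have hstep : 8 * 2 ^ (k + 1) * (1 + 64 * (k + 1)) ≤ 4 * (8 * 2 ^ k * (1 + 64 * k)) := by
      have : 2 * (1 + 64 * (k + 1)) ≤ 4 * (1 + 64 * k) := by omega
      calc 8 * 2 ^ (k + 1) * (1 + 64 * (k + 1)) = (8 * 2 ^ k) * (2 * (1 + 64 * (k + 1))) := by ring
        _ ≤ (8 * 2 ^ k) * (4 * (1 + 64 * k)) := Nat.mul_le_mul_left _ this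
        _ = 4 * (8 * 2 ^ k * (1 + 64 * k)) := by ring
    calc 8 * 2 ^ (k + 1) * (1 + 64 * (k + 1)) ≤ 4 * (8 * 2 ^ k * (1 + 64 * k)) := hstep
      _ ≤ 256 * 256 ^ k := Nat.mul_le_mul (by norm_num) ih
      _ = 256 ^ (k + 1) := by ring

/-- **(NP-Γ), explicit constants**: `e = 6`, `C = 8`, `n₀ = 200`. -/
theorem ringHardSparse3_explicit : ∀ N ≥ 200, ∀ 𝓢 : Set (Finset (Fin N)),
    InsulatedWindows 𝓢 (8 * Nat.log 2 N) →
    ∀ P : Fin N → Smolensky.CubeFn (ZMod 3) N,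
      (∀ i, P i ∈ Submodule.span (ZMod 3) (Smolensky.mono (ZMod 3) '' 𝓢)) →
      ((univ.filter fun x : Fin N → Bool =>
          OddZeros x ∧ RingHLF.Rel x (fun i => decide (P i x = 1))).card : ℝ) ≤
        (1 - 1 / (N : ℝ) ^ 6) * (2 : ℝ) ^ (N - 1) := by
  intro N hN 𝓢 hW P hP
  obtain ⟨n, rfl⟩ : ∃ n, N = n + 1 := ⟨N - 1, by omega⟩
  obtain ⟨p, q, _, hqF3, hord, h4, h5⟩ := hW
  obtain ⟨h1, h2⟩ := H1'_H2'_of_insulated h4 h5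
  have hqF : q (8 * Nat.log 2 (n + 1)) < n := by omega
  have hS := sep_of_ord hord hqF
  have hSAIA := fun g => SA_IA_of_mem_span hS h1 h2 (hP g)
  -- numerics in `k = log₂ (n+1) ≥ 7`
  set k := Nat.log 2 (n + 1) with hk
  have hk7 : 7 ≤ k := by
    rw [hk]
    exact Nat.le_log_of_pow_le (by norm_num) (by omega)
  have hNlt : n + 1 < 2 ^ (k + 1) := Nat.lt_pow_succ_log_self (by norm_num) (n + 1)
  have h2k : 2 ^ k ≤ n + 1 := Nat.pow_log_le_self 2 (by omega)
  have hkN : k < n + 1 := lt_of_lt_of_le (Nat.lt_two_pow_self) h2k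
  have h34N : 16 * (n + 1) * 3 ^ (8 * k) ≤ 4 ^ (8 * k) := by
    have hA := growthA k (by omega)
    calc 16 * (n + 1) * 3 ^ (8 * k) ≤ 16 * 2 ^ (k + 1) * 3 ^ (8 * k) :=
          Nat.mul_le_mul_right _ (Nat.mul_le_mul_left _ hNlt.le)
      _ = 32 * (2 ^ k * (3 ^ 8) ^ k) := by rw [← pow_mul]; ring
      _ = 32 * 13122 ^ k := by rw [← mul_pow]; norm_num
      _ ≤ 65536 ^ k := hA
      _ = 4 ^ (8 * k) := by rw [pow_mul]; norm_num
  have h2C : 4 * (n + 1) * (1 + 8 * (8 * k)) ≤ 2 ^ (8 * k) := by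
    have hB := growthB k (by omega)
    calc 4 * (n + 1) * (1 + 8 * (8 * k)) ≤ 4 * 2 ^ (k + 1) * (1 + 8 * (8 * k)) :=
          Nat.mul_le_mul_right _ (Nat.mul_le_mul_left _ hNlt.le)
      _ = 8 * 2 ^ k * (1 + 64 * k) := by ring
      _ ≤ 256 ^ k := hB
      _ = 2 ^ (8 * k) := by rw [pow_mul]; norm_num
  have hmain := sparseLoss hord hqF (by omega) P (fun g => (hSAIA g).1) (fun g => (hSAIA g).2) h34N h2C
  rw [card_Ix] at hmain
  -- the size of the family against `N^6`
  have hK : 2 * 2 ^ L ((n + 1) * (6 + 8 * (8 * k)) + 1) ≤ (n + 1) ^ 6 := by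
    have hL := two_pow_L_le ((n + 1) * (6 + 8 * (8 * k)) + 1) (by omega)
    have hq : (n + 1) * (6 + 8 * (8 * k)) + 1 ≤ 70 * (n + 1) ^ 2 := by
      have hk' : 6 + 8 * (8 * k) ≤ 69 * (n + 1) := by omega
      have h1 : (n + 1) * (6 + 8 * (8 * k)) ≤ (n + 1) * (69 * (n + 1)) := Nat.mul_le_mul_left _ hk'
      have h2 : 1 ≤ (n + 1) * (n + 1) := Nat.one_le_iff_ne_zero.mpr (by positivity)
      calc (n + 1) * (6 + 8 * (8 * k)) + 1 ≤ (n + 1) * (69 * (n + 1)) + (n + 1) * (n + 1) := add_le_add h1 h2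
        _ = 70 * (n + 1) ^ 2 := by ring
    have hq2 : ((n + 1) * (6 + 8 * (8 * k)) + 1) ^ 2 ≤ (70 * (n + 1) ^ 2) ^ 2 := Nat.pow_le_pow_left hq 2
    have h200 : 39200 ≤ (n + 1) ^ 2 := by
      calc 39200 ≤ 200 * 200 := by norm_num
        _ ≤ (n + 1) * (n + 1) := Nat.mul_le_mul hN hN
        _ = (n + 1) ^ 2 := by ring
    calc 2 * 2 ^ L ((n + 1) * (6 + 8 * (8 * k)) + 1) ≤ 2 * (4 * (70 * (n + 1) ^ 2) ^ 2) :=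
          Nat.mul_le_mul_left 2 (hL.trans (Nat.mul_le_mul_left 4 hq2))
      _ = 39200 * (n + 1) ^ 4 := by ring
      _ ≤ (n + 1) ^ 2 * (n + 1) ^ 4 := Nat.mul_le_mul_right _ h200
      _ = (n + 1) ^ 6 := by ring
  have hKR : 2 * (2 : ℝ) ^ L ((n + 1) * (6 + 8 * (8 * k)) + 1) ≤ ((n : ℝ) + 1) ^ 6 := by exact_mod_cast hK
  rw [show n + 1 - 1 = n from rfl]
  push_cast
  have h2n : (0 : ℝ) < (2 : ℝ) ^ n := by positivity
  have hdiv : (2 : ℝ) ^ n / ((n : ℝ) + 1) ^ 6 ≤ (2 : ℝ) ^ n / (2 * (2 : ℝ) ^ L ((n + 1) * (6 + 8 * (8 * k)) + 1)) :=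
    div_le_div_of_nonneg_left h2n.le (by positivity) hKR
  calc (((univ.filter fun x : Fin (n + 1) → Bool =>
          OddZeros x ∧ RingHLF.Rel x (fun i => decide (P i x = 1))).card : ℕ) : ℝ)
      ≤ (2 : ℝ) ^ n - (2 : ℝ) ^ n / (2 * (2 : ℝ) ^ L ((n + 1) * (6 + 8 * (8 * k)) + 1)) := hmain
    _ ≤ (2 : ℝ) ^ n - (2 : ℝ) ^ n / ((n : ℝ) + 1) ^ 6 := by linarith
    _ = (1 - 1 / ((n : ℝ) + 1) ^ 6) * (2 : ℝ) ^ n := by ring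

/-- **(NP-Γ) PROVED**: `RingHardSparse3` with `e = 6`, `C = 8`, `n₀ = 200`. -/
theorem ringHardSparse3 : RingHardSparse3 := ⟨6, 8, 200, ringHardSparse3_explicit⟩

end Slicing

end Summit.QuantumAdvantage.AdviceFreeQNC0.NPGamma37Proof
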